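import Summits.CriticalPhenomena.PercolationContinuityZ3.Theorems.PercNearOneGluingNoHeavyLowerTailSahiInterpCheck

/-!
# The interpolation leaf test for Sahi's `E_n` on `{0,1}^m`, IX: the order-10 certificate data `H`, `c`

Support file (cell `prim-sahi`, seat `prim-sahi-typer` gen 30; `--supports stmt-CriticalPhenomena-4575`).  DATA ONLY (three computable definitions,
nothing evaluated, nothing asserted): the integer matrix `H = c · B⁻¹` for `B_{y,k} = y^k (10 − y)^{10 − k}` (`y, k = 0, …, 10`; the scaled Bernstein
basis of degree 10 evaluated on the grid `{0, 1/10, …, 1}`) with `c = 45 360 000 000 000` the least common denominator of `B⁻¹` (exact rational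
inversion outside Lean; `max |H_{k,y}| = 1 048 960 080`).  Whether `H · B = c · 1` is NOT assumed anywhere: the leaf test …`SahiInterpCheck.testI`
re-checks it (`checkH`) at run time, and …`SahiInterpSound.testI_sound` uses only that check.  Consumed by the computational chunks
…`SahiSymCubeFive10A/B` (`symCheckT 5 10 (testI 5 10 hTen cTen)`). [this work]
-/

namespace Summit.CriticalPhenomena.PercolationContinuityZ3.Theorems.SahiInterp

/-- The rows `H_{k,·}`, `k = 0, …, 10`, of `c · B⁻¹`. [this work] -/
def hTenArr : Array (Array ℤ) := #[
  #[4536, 0, 0, 0, 0, 0, 0, 0, 0, 0, 0],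
  #[-87498, 453600, -1020600, 1814400, -2381400, 2286144, -1587600, 777600, -255150, 50400, -4536],
  #[602595, -4667400, 15604650, -30765600, 42364350, -41812848, 29565900, -14666400, 4857975, -966600, 87498],
  #[-1996867, 18252900, -73165275, 169251600, -252815850, 261895032, -191197650, 97016400, -32681475, 6588100, -602595],
  #[3558504, -35410600, 156633975, -403826400, 669131400, -744525936, 571438350, -300741600, 104153400, -21455400, 1996867],
  #[-3558504, 37155000, -174127500, 481140000, -864517500, 1048960080, -864517500, 481140000, -174127500, 37155000, -3558504],
  #[1996867, -21455400, 104153400, -300741600, 571438350, -744525936, 669131400, -403826400, 156633975, -35410600, 3558504],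
  #[-602595, 6588100, -32681475, 97016400, -191197650, 261895032, -252815850, 169251600, -73165275, 18252900, -1996867],
  #[87498, -966600, 4857975, -14666400, 29565900, -41812848, 42364350, -30765600, 15604650, -4667400, 602595],
  #[-4536, 50400, -255150, 777600, -1587600, 2286144, -2381400, 1814400, -1020600, 453600, -87498],
  #[0, 0, 0, 0, 0, 0, 0, 0, 0, 0, 4536] ]

/-- The certificate matrix `H` of order 10 as a function. [this work] -/
def hTen : Fin 11 → Fin 11 → ℤ := fun k y => (hTenArr.getD k #[]).getD y 0

/-- The certificate constant `c = 45 360 000 000 000` of order 10. [this work] -/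
def cTen : ℤ := 45360000000000

end Summit.CriticalPhenomena.PercolationContinuityZ3.Theorems.SahiInterp
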